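import Summits.QuantumFields.BalabanUV.Beta.FP.HorizontalBookkeeping
import Summits.QuantumFields.BalabanUV.Beta.FP.TransportProfileMoments

/-!
# `BalabanUV.Beta.FP.HorizontalBookkeepingDefectLetters` — road «FP», N7 H-route, row H3-BOOK (a)/(b-T) junction: THE THREE TRANSPORT LETTERS OF THE
# (T0)-DEFECT FROM THE SUP PROFILE — second moments `≤ c₂·N`, first moments `≤ c₁`, and the AFFINE-REPRODUCTION CONSTANTS `|Cw κ l μ| ≤ c_C/N⁴` (coset first
# moment: ONE coset carries `N⁻⁴` of the profile's mass), hence `N⁶·|t0Defect| ≤ 16·A·(2c₂ + 2c_C·c₁)` from `|M₀(T)| ≤ A/N²` alone ([folklore]; nothing of the manuscripts)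

HONEST DEPENDENCY (page 1, mandatory): continuum YM on T⁴ ⇐ BetaPertH ∧ nine spine estimates (0/9 proved); BetaPertH ⇐ (D1) ∧ (D4) ∧
CAP+tail; G-an2-4 gates asym, D1 and NE2/3/4.  HONEST FRAMING (cell contract, verbatim): «discharging `BetaPertH` makes Bałaban's UV
stability UNCONDITIONAL — a real constructive-QFT result; it is NOT the continuum limit and NOT the Clay problem.»  THIS MODULE composes BY NAME g5's
`FP/HorizontalBookkeeping.pow_six_mul_abs_t0Defect_le` and `FP/TransportProfileMoments.letters_at_scale` with the decimation reindexing
`DecimatedMomentLimit.tsum_decimate` and `FP/StencilMoments.summable_of_weight_exp`.  Every analytic input (the profile, the (T0)-smallness `|M₀(T c e)| ≤ A/N²`) is a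
HYPOTHESIS displayed in the signatures; it cites nothing, defines nothing, mints no `Prop` fact, 0 sorry.  NOT the (T0)-smallness itself (a Ward-at-zero-momentum
+ decay letter of the kernel, the assembler's/H2's), NOT `hbook`, NOT `hasym`, NOT D1, NOT BetaPertH, NOT continuum, NOT Clay.

CONTENT.
* `affineConst_eq_tsum_decimated` — (L1∞) read at the origin: `Cw μ = Σ'_z ((N•z)_μ)·w (N•z)` (`tsum_decimate`).
* **`abs_affineConst_le`** — `|w x| ≤ (c/N⁵)·e^{−(δ/N)|x|₁}` + `LinReproSum N w Cw` ⟹ `|Cw μ| ≤ c·(e^{δ/2}·(2/δ)·(1+4/δ)⁴)/N⁴` (on the coset `N•ℤ⁴` the profile is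
  `(c/N⁵)·e^{−δ|z|₁}` and the weight is `N·|z_μ|`).
* `t0Defect_letters_of_supProfile` — the three letters `hB2`/`hB1`/`hBC` of `pow_six_mul_abs_t0Defect_le` in its exact shapes;
  **`pow_six_mul_abs_t0Defect_le_of_supProfile`** — `N⁶·|t0Defect N w T Cw κ l a b| ≤ 16·A·(2·c₂ + 2·c_C·c₁)` with
  `c₂ := 2c·e^{δ/2}(2/δ)²(1+4/δ)⁴`, `c₁ := c·e^{δ/2}(2/δ)(1+4/δ)⁴`, `c_C := c·e^{δ/2}(2/δ)(1+4/δ)⁴`, from `|Σ' T c e| ≤ A/N²` — the (a)-side bound `|E₀| ≤ U₀` of the assembler.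
Unit `b2b-balaban-beta-d1-formalise-leaf-02` (gen 6).
-/

noncomputable section

namespace Summit.QuantumFields.BalabanUV.Beta.FP.HorizontalBookkeepingDefectLetters

open Finset Filter Topology
open scoped BigOperators
open Literature.MathematicalPhysics.QuantumFieldTheory.Balaban1983to89
open Literature.MathematicalPhysics.QuantumFieldTheory.Balaban1983to89.Beta
open B12Sec2to5 (l1 l1_nonneg abs_coord_le_l1)
open ExpKernelCalculus (Site Zl Zl_pos l1_natSmul)
open LatticeConstantZl (Zl_le_elem)
open DecimatedMoment (cosetInd cosetInd_neg)
open DecimatedMomentLimit (tsum_decimate)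
open DecimatedMomentSummable (ConstReproSum LinReproSum)
open DressedMomentNormalisation (EKer)
open Summit.QuantumFields.BalabanUV.Beta.FP.StencilMoments (summable_of_weight_exp)
open Summit.QuantumFields.BalabanUV.Beta.FP.TransportProfileMoments (letters_at_scale)
open Summit.QuantumFields.BalabanUV.Beta.FP.HorizontalBookkeeping (t0Defect pow_six_mul_abs_t0Defect_le)
open DyadicShell (Pt)

/-- [folklore] **(L1∞) READ AT THE ORIGIN, DECIMATED**: `LinReproSum N w Cw` ⟹ `Cw μ = Σ'_z ((N•z)_μ)·w (N•z)` (`N ≥ 1`). -/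
theorem affineConst_eq_tsum_decimated {w : Pt → ℝ} {Cw : Fin 4 → ℝ} {N : ℕ} (hN : 1 ≤ N) (hw1 : LinReproSum N w Cw) (μ : Fin 4) :
    Cw μ = ∑' z : Pt, (((N : ℤ) • z) μ) • w ((N : ℤ) • z) := by
  have h := hw1 0 μ
  have e : (fun u : Pt => (cosetInd N (0 - u) * u μ) • w u) = fun u : Pt => (cosetInd N u * u μ) • w u := by
    funext u; rw [zero_sub, cosetInd_neg]
  rw [e] at h
  rw [← h.tsum_eq, tsum_decimate (Nat.one_le_iff_ne_zero.mp hN) (fun y => y μ) w]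

/-- **THE AFFINE-REPRODUCTION CONSTANTS ARE `O(N⁻⁴)`**: `|w x| ≤ (c/N⁵)·e^{−(δ/N)|x|₁}` (`δ > 0`, `N ≥ 1`, `c ≥ 0`) and `LinReproSum N w Cw` ⟹
`|Cw μ| ≤ c·(e^{δ/2}·(2/δ)·(1+4/δ)⁴)/N⁴` — on the coset `N•ℤ⁴` the profile reads `(c/N⁵)·e^{−δ|z|₁}` and the weight `|(N•z)_μ| ≤ N·(|z|₁+1)`. [folklore] -/
theorem abs_affineConst_le {w : Pt → ℝ} {Cw : Fin 4 → ℝ} {c δ : ℝ} {N : ℕ} (hN : 1 ≤ N) (hδ : 0 < δ) (hc : 0 ≤ c)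
    (hw1 : LinReproSum N w Cw) (hw : ∀ x, |w x| ≤ c / (N : ℝ) ^ 5 * Real.exp (-(δ / N) * l1 x)) (μ : Fin 4) :
    |Cw μ| ≤ c * (Real.exp (δ / 2) * (2 / δ) * (1 + 4 / δ) ^ 4) / (N : ℝ) ^ 4 := by
  have hN' : (1 : ℝ) ≤ N := by exact_mod_cast hN
  have hX : (0 : ℝ) < N := by linarith
  have hX0 : (N : ℝ) ≠ 0 := hX.ne'
  rw [affineConst_eq_tsum_decimated hN hw1 μ]
  -- the decimated family is dominated by `(c/N⁴)·(|z|₁+1)·e^{−δ|z|₁}`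
  have hg : ∀ z : Pt, |(((N : ℤ) • z) μ) • w ((N : ℤ) • z)| ≤ c / (N : ℝ) ^ 4 * (l1 (z - 0) + 1) ^ 1 * Real.exp (-δ * l1 (z - 0)) := by
    intro z
    rw [sub_zero, pow_one, zsmul_eq_mul, abs_mul]
    have h1 : |((((N : ℤ) • z) μ : ℤ) : ℝ)| ≤ (N : ℝ) * (l1 z + 1) := by
      have e : ((((N : ℤ) • z) μ : ℤ) : ℝ) = (N : ℝ) * (z μ : ℝ) := by simp [Pi.smul_apply]
      rw [e, abs_mul, abs_of_nonneg hX.le]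
      exact mul_le_mul_of_nonneg_left ((abs_coord_le_l1 z μ).trans (by linarith)) hX.le
    have h2 : |w ((N : ℤ) • z)| ≤ c / (N : ℝ) ^ 5 * Real.exp (-δ * l1 z) := by
      have h := hw ((N : ℤ) • z)
      rw [l1_natSmul] at h
      rwa [show -(δ / (N : ℝ)) * ((N : ℝ) * l1 z) = -δ * l1 z by field_simp] at h
    calc |((((N : ℤ) • z) μ : ℤ) : ℝ)| * |w ((N : ℤ) • z)| ≤ ((N : ℝ) * (l1 z + 1)) * (c / (N : ℝ) ^ 5 * Real.exp (-δ * l1 z)) :=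
          mul_le_mul h1 h2 (abs_nonneg _) (by have := l1_nonneg z; positivity)
      _ = c / (N : ℝ) ^ 4 * (l1 z + 1) * Real.exp (-δ * l1 z) := by field_simp
  obtain ⟨hs, hb⟩ := summable_of_weight_exp (q := (0 : Pt)) (k := 1) hδ (by positivity : 0 ≤ c / (N : ℝ) ^ 4) hg
  have h1 : |∑' z : Pt, (((N : ℤ) • z) μ) • w ((N : ℤ) • z)| ≤ ∑' z : Pt, |(((N : ℤ) • z) μ) • w ((N : ℤ) • z)| := by
    have := norm_tsum_le_tsum_norm hs.norm
    simpa only [Real.norm_eq_abs] using this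
  refine h1.trans (hb.trans ?_)
  simp only [Nat.factorial_one, Nat.cast_one, one_mul, pow_one]
  have hZ := Zl_le_elem (half_pos hδ) 4
  have e4 : (1 + 2 / (δ / 2)) = 1 + 4 / δ := by field_simp; ring
  rw [e4] at hZ
  calc c / (N : ℝ) ^ 4 * (Real.exp (δ / 2) * (2 / δ)) * Zl 4 (δ / 2)
      ≤ c / (N : ℝ) ^ 4 * (Real.exp (δ / 2) * (2 / δ)) * (1 + 4 / δ) ^ 4 := mul_le_mul_of_nonneg_left hZ (by positivity)
    _ = c * (Real.exp (δ / 2) * (2 / δ) * (1 + 4 / δ) ^ 4) / (N : ℝ) ^ 4 := by field_simp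

/-- [folklore] **THE THREE LETTERS OF THE (T0)-DEFECT FROM THE SUP PROFILE**, in the exact shapes of `HorizontalBookkeeping.pow_six_mul_abs_t0Defect_le`:
second moments `≤ c₂·N`, first moments `≤ c₁`, affine constants `≤ c_C/N⁴`. -/
theorem t0Defect_letters_of_supProfile {w : EKer 4} {Cw : Fin 4 → Fin 4 → Fin 4 → ℝ} {c δ : ℝ} {N : ℕ} (hN : 1 ≤ N) (hδ : 0 < δ) (hc : 0 ≤ c)
    (hw1 : ∀ κ l, LinReproSum N (w κ l) (Cw κ l)) (hw : ∀ κ l x, |w κ l x| ≤ c / (N : ℝ) ^ 5 * Real.exp (-(δ / N) * l1 x))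
    (κ l : Fin 4) :
    (∀ c' e, |∑' x, (x κ * x l) • w c' e x| ≤ (2 * c * Real.exp (δ / 2) * (2 / δ) ^ 2 * (1 + 4 / δ) ^ 4) * N)
      ∧ (∀ c' e (μ : Fin 4), |∑' x, x μ • w c' e x| ≤ c * Real.exp (δ / 2) * (2 / δ) * (1 + 4 / δ) ^ 4)
      ∧ (∀ c' e (μ : Fin 4), |Cw c' e μ| ≤ (c * (Real.exp (δ / 2) * (2 / δ) * (1 + 4 / δ) ^ 4)) / (N : ℝ) ^ 4) := by
  have hN' : (1 : ℝ) ≤ N := by exact_mod_cast hN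
  have hX : (0 : ℝ) < N := by linarith
  have hc' : 0 ≤ c / (N : ℝ) ^ 5 := by positivity
  refine ⟨fun c' e => ?_, fun c' e μ => ?_, fun c' e μ => abs_affineConst_le hN hδ hc (hw1 c' e) (hw c' e) μ⟩
  · have h := (letters_at_scale (D := 4) hδ hN hc' (hw c' e) κ κ l).2.2
    refine h.trans (le_of_eq ?_)
    field_simp
  · have h := (letters_at_scale (D := 4) hδ hN hc' (hw c' e) μ κ l).2.1
    refine h.trans (le_of_eq ?_)
    field_simp

/-- **THE (T0)-DEFECT BOUND OF THE ASSEMBLER's (a) FROM THE SUP PROFILE**: transport entries with (L1∞) constants `Cw` and the profile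
`|w κ l x| ≤ (c/N⁵)·e^{−(δ/N)|x|₁}`, a middle factor `T` with the (T0)-smallness `|Σ'_t T c e t| ≤ A/N²` (`N ≥ 1`) ⟹
`N⁶·|t0Defect N w T Cw κ l a b| ≤ 16·A·(2·c₂ + 2·c_C·c₁)` with the displayed `c₂, c₁, c_C` — FREE OF `N`. [folklore] -/
theorem pow_six_mul_abs_t0Defect_le_of_supProfile {w T : EKer 4} {Cw : Fin 4 → Fin 4 → Fin 4 → ℝ} {c δ A : ℝ} {N : ℕ} (hN : 1 ≤ N)
    (hδ : 0 < δ) (hc : 0 ≤ c) (hw1 : ∀ κ l, LinReproSum N (w κ l) (Cw κ l))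
    (hw : ∀ κ l x, |w κ l x| ≤ c / (N : ℝ) ^ 5 * Real.exp (-(δ / N) * l1 x))
    (hA : ∀ c' e, |∑' t, T c' e t| ≤ A / (N : ℝ) ^ 2) (κ l a b : Fin 4) :
    (N : ℝ) ^ 6 * |t0Defect N w T Cw κ l a b|
      ≤ 16 * A * (2 * ((2 * c * Real.exp (δ / 2) * (2 / δ) ^ 2 * (1 + 4 / δ) ^ 4))
          + 2 * (c * (Real.exp (δ / 2) * (2 / δ) * (1 + 4 / δ) ^ 4)) * (c * Real.exp (δ / 2) * (2 / δ) * (1 + 4 / δ) ^ 4)) := by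
  obtain ⟨hB2, hB1, hBC⟩ := t0Defect_letters_of_supProfile hN hδ hc hw1 hw κ l
  exact pow_six_mul_abs_t0Defect_le hN w T Cw κ l a b hA hB2 hB1 hBC

end Summit.QuantumFields.BalabanUV.Beta.FP.HorizontalBookkeepingDefectLetters

end
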